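import Mathlib
import HarnessLib

/-!
# [OURS · L1 W4.5(b) · EL♮(3) · NOSE D6-2] EQ3 — THE NODE STRICT-TRANSFORM CHART LEMMA (relative ordinary node ⇒ `O`-smooth strict transform)

res-L1-w45b-nose-w2 g2 (WIDTH seat on D-0157 DOOR 1; WIDTH TABLE D6 row (D6-2), desk RULING R52). OURS; NOT a statement of any manuscript ([Hironaka2017] is a
candidate under adjudication, nothing of it is asserted); AI-written, weaker than expert review. No `sorry`; standard axioms; DEF-FREE. `--kind proof --supports
stmt-ResolutionOfSingularities-20148 --as helper`; closes nothing. Resolution of singularities in positive characteristic is NOT proved here or anywhere in this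
chain (dimension 3 is Cossart–Piltant 2008/2009 in print); EL♮(3) is NOT proved by this file.

WHAT (NU4-SIZING v5/v6 §M.2 (c), idea-3's sketch signature VERBATIM, plus the symmetric chart). `G ∈ O[u,v]` over ANY nontrivial commutative ring `O`,
vanishing to order two at the origin (`coeff 0 = coeff u = coeff v = 0`) with UNIT tangent-cone discriminant `b² − 4ac` (`a, b, c` the coefficients of
`u², uv, v²`; no division by 2 — every characteristic). In the blow-up chart `u = v·u′`: `G(v u′, v) = v² G′` with `(G′, ∂_{u′} G′, v) = (1)` (Jacobian unit
⇒ `V(G′)` is `O`-smooth along `v = 0`) and `v ∤ G′` (no component in the exceptional divisor). PROOF: `G = a u² + b uv + c v² + H`, `H` without monomials of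
degree `≤ 2`, so `H(v u′, v) = v³ H₁` and `G′ = a u′² + b u′ + c + v H₁`; `(∂G′)² − 4a G′ = (b² − 4ac) + v·E`; and `v ∣ G′` forces `a = b = c = 0`, i.e.
`b² − 4ac = 0` a unit, absurd. §1 the chart `u = v·u′` (★ `node_strictTransform_chart`); §2 the chart `v = u·v′` (★ `node_strictTransform_chart'`) by the swap
`u ↔ v` (`rename`, `pderiv_rename`).
-/

set_option linter.dupNamespace false -- mandated namespace `Summit.<Summit>.<Problem>` of this single-conjunct summit

noncomputable section

open MvPolynomial

namespace Summit.ResolutionOfSingularities.ResolutionOfSingularities.Cruxes.EquisingularLiftNat.Sections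

namespace NodeChart

variable {O : Type} [CommRing O]

/-- **Hu's substitution `u ↦ u·v`, `v ↦ v` on a polynomial without monomials of degree `≤ 2` is divisible by `v³`** (each monomial `uⁱvʲ ↦ uⁱvⁱ⁺ʲ`,
`i + j ≥ 3`). [folklore] -/
theorem X_pow_three_dvd_aeval_of_coeff_eq_zero (H : MvPolynomial (Fin 2) O) (hH : ∀ m : Fin 2 →₀ ℕ, m 0 + m 1 ≤ 2 → coeff m H = 0) :
    X 1 ^ 3 ∣ aeval (fun i : Fin 2 => if i = 0 then X 0 * X 1 else (X 1 : MvPolynomial (Fin 2) O)) H := by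
  rw [H.as_sum, map_sum]
  refine Finset.dvd_sum fun m hm => ?_
  have h3 : 3 ≤ m 0 + m 1 := by
    by_contra h
    exact (mem_support_iff.mp hm) (hH m (by omega))
  rw [aeval_monomial, Finsupp.prod_of_support_subset m (Finset.subset_univ _) _ (fun i _ => pow_zero _), Fin.prod_univ_two]
  simp only [Fin.isValue, ↓reduceIte, one_ne_zero]
  rw [mul_pow, show (X 0 : MvPolynomial (Fin 2) O) ^ m 0 * X 1 ^ m 0 * X 1 ^ m 1 = X 0 ^ m 0 * X 1 ^ (m 0 + m 1) by ring]
  exact Dvd.dvd.mul_left (Dvd.dvd.mul_left (pow_dvd_pow (X 1) h3) _) _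

/-- ★ **THE NODE STRICT-TRANSFORM CHART LEMMA, chart `u = v·u′`** (EQ3 of NU4-SIZING §M.2 (c), signature verbatim): for `G ∈ O[u,v]` with
`G(0) = ∂G(0) = 0` and unit tangent-cone discriminant `b² − 4ac`, the strict transform `G′` (`G(v u′, v) = v² G′`) satisfies the Jacobian unit condition
`(G′, ∂_{u′}G′, v) = (1)` and is not divisible by `v`. Every characteristic (no division by 2). [OURS · L1 W4.5b · NOSE D6-2 · EQ3] -/
theorem node_strictTransform_chart (O : Type) [CommRing O] [Nontrivial O]
    (G : MvPolynomial (Fin 2) O)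
    (h00 : coeff 0 G = 0) (h10 : coeff (Finsupp.single 0 1) G = 0)
    (h01 : coeff (Finsupp.single 1 1) G = 0)
    (hdisc : IsUnit (coeff (Finsupp.single 0 1 + Finsupp.single 1 1) G ^ 2
      - 4 * coeff (Finsupp.single 0 2) G * coeff (Finsupp.single 1 2) G)) :
    ∃ G' : MvPolynomial (Fin 2) O,
      aeval (fun i : Fin 2 => if i = 0 then X 0 * X 1 else (X 1 : MvPolynomial (Fin 2) O)) G
        = X 1 ^ 2 * G' ∧
      (∃ A B C : MvPolynomial (Fin 2) O, A * G' + B * pderiv 0 G' + C * X 1 = 1) ∧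
      ¬ (X 1 ∣ G') := by
  -- the tangent cone `a u² + b uv + c v²` and the remainder `H`
  set a := coeff (Finsupp.single 0 2) G with ha
  set b := coeff (Finsupp.single 0 1 + Finsupp.single 1 1) G with hb
  set c := coeff (Finsupp.single 1 2) G with hc
  set H : MvPolynomial (Fin 2) O :=
    G - (monomial (Finsupp.single 0 2) a + monomial (Finsupp.single 0 1 + Finsupp.single 1 1) b + monomial (Finsupp.single 1 2) c) with hHdef
  have hH : ∀ m : Fin 2 →₀ ℕ, m 0 + m 1 ≤ 2 → coeff m H = 0 := by
    intro m hm
    have key : m = Finsupp.single 0 (m 0) + Finsupp.single 1 (m 1) := by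
      ext i; fin_cases i <;> simp  -- (cf. ✓ `Literature.NumberTheory.EllipticCurves.finsupp_fin_two_eq`)
    have h0 : m 0 ≤ 2 := by omega
    have h1 : m 1 ≤ 2 := by omega
    rw [hHdef, coeff_sub, coeff_add, coeff_add, coeff_monomial, coeff_monomial, coeff_monomial]
    interval_cases h0' : m 0 <;> interval_cases h1' : m 1 <;> (try omega) <;>
      · rw [key]
        simp [Finsupp.ext_iff, Fin.forall_fin_two, ha, hb, hc]
        first
          | exact h00
          | simpa using h10
          | simpa using h01
          | skip
  -- `H(v u′, v) = v³ H₁`, so `G(v u′, v) = v² (a u′² + b u′ + c + v H₁)`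
  obtain ⟨H₁, hH₁⟩ := X_pow_three_dvd_aeval_of_coeff_eq_zero H hH
  have hXX : (monomial (Finsupp.single 0 1 + Finsupp.single 1 1) b : MvPolynomial (Fin 2) O) = C b * (X 0 * X 1) := by
    rw [X, X, monomial_mul, C_mul_monomial]; simp
  have hG : G = (C a * X 0 ^ 2 + C b * (X 0 * X 1) + C c * X 1 ^ 2) + H := by
    rw [hHdef, ← C_mul_X_pow_eq_monomial, ← C_mul_X_pow_eq_monomial, hXX]; ring
  set G' : MvPolynomial (Fin 2) O := C a * X 0 ^ 2 + C b * X 0 + C c + X 1 * H₁ with hG'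
  have hmain : aeval (fun i : Fin 2 => if i = 0 then X 0 * X 1 else (X 1 : MvPolynomial (Fin 2) O)) G = X 1 ^ 2 * G' := by
    rw [hG, map_add, hH₁]
    simp only [map_add, map_mul, map_pow, aeval_C, aeval_X, algebraMap_eq]
    simp only [Fin.isValue, ↓reduceIte, one_ne_zero]
    rw [hG']; ring
  -- the Jacobian unit condition: `(∂G′)² − 4a·G′ = (b² − 4ac) + v·E`
  obtain ⟨d, hd⟩ := hdisc.exists_left_inv
  have hP : pderiv 0 G' = 2 * C a * X 0 + C b + X 1 * pderiv 0 H₁ := by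
    rw [hG']
    simp only [map_add, Derivation.leibniz, Derivation.leibniz_pow, pderiv_C, pderiv_X, smul_eq_mul]
    simp
    ring
  have hd' : C d * (C b ^ 2 - 4 * C a * C c) = (1 : MvPolynomial (Fin 2) O) := by
    have h := congrArg (C : O → MvPolynomial (Fin 2) O) hd
    simpa [map_mul, map_sub, map_pow, map_ofNat] using h
  refine ⟨G', hmain, ⟨-(4 * C d * C a), C d * pderiv 0 G',
    -(C d * (2 * (2 * C a * X 0 + C b) * pderiv 0 H₁ + X 1 * pderiv 0 H₁ ^ 2 - 4 * C a * H₁)), ?_⟩, ?_⟩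
  · rw [hP, hG']
    linear_combination hd'
  · -- `v ∣ G′` forces `a = b = c = 0`, so the unit discriminant vanishes: absurd
    rintro ⟨K, hK⟩
    have z2 : (0 : Fin 2 →₀ ℕ) ≠ Finsupp.single 0 2 := (Finsupp.single_ne_zero.mpr (by norm_num)).symm
    have z1 : (0 : Fin 2 →₀ ℕ) ≠ Finsupp.single 0 1 := (Finsupp.single_ne_zero.mpr (by norm_num)).symm
    have e2 : coeff (Finsupp.single 0 2) G' = a := by
      rw [hG']; simp [coeff_X_mul', coeff_X, coeff_C, coeff_X_pow, Finsupp.single_eq_single_iff, z2]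
    have e1 : coeff (Finsupp.single 0 1) G' = b := by
      rw [hG']; simp [coeff_X_mul', coeff_X, coeff_C, coeff_X_pow, Finsupp.single_eq_single_iff, z1]
    have e0 : coeff 0 G' = c := by
      rw [hG']; simp [coeff_X_mul', coeff_X, coeff_C, coeff_X_pow]
    have k2 : coeff (Finsupp.single 0 2) (X 1 * K) = 0 := by simp [coeff_X_mul']
    have k1 : coeff (Finsupp.single 0 1) (X 1 * K) = 0 := by simp [coeff_X_mul']
    have k0 : coeff 0 (X 1 * K) = 0 := by simp [coeff_X_mul']
    rw [← hK, e2] at k2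
    rw [← hK, e1] at k1
    rw [← hK, e0] at k0
    rw [k2, k1, k0] at hdisc
    simp at hdisc

/-- ★ **THE NODE STRICT-TRANSFORM CHART LEMMA, chart `v = u·v′`** (the symmetric chart, by the swap `u ↔ v`: `rename`, `aeval_rename`, `pderiv_rename`).
[OURS · L1 W4.5b · NOSE D6-2 · EQ3] -/
theorem node_strictTransform_chart' (O : Type) [CommRing O] [Nontrivial O]
    (G : MvPolynomial (Fin 2) O)
    (h00 : coeff 0 G = 0) (h10 : coeff (Finsupp.single 0 1) G = 0)
    (h01 : coeff (Finsupp.single 1 1) G = 0)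
    (hdisc : IsUnit (coeff (Finsupp.single 0 1 + Finsupp.single 1 1) G ^ 2
      - 4 * coeff (Finsupp.single 0 2) G * coeff (Finsupp.single 1 2) G)) :
    ∃ G' : MvPolynomial (Fin 2) O,
      aeval (fun i : Fin 2 => if i = 1 then X 0 * X 1 else (X 0 : MvPolynomial (Fin 2) O)) G
        = X 0 ^ 2 * G' ∧
      (∃ A B C : MvPolynomial (Fin 2) O, A * G' + B * pderiv 1 G' + C * X 0 = 1) ∧
      ¬ (X 0 ∣ G') := by
  set s : Equiv.Perm (Fin 2) := Equiv.swap 0 1 with hs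
  have hs0 : s 0 = 1 := by simp [hs]
  have hs1 : s 1 = 0 := by simp [hs]
  have hss : ∀ p : MvPolynomial (Fin 2) O, rename s (rename s p) = p := fun p => by
    rw [rename_rename]
    have : (s ∘ s : Fin 2 → Fin 2) = id := by funext i; simp [hs, Equiv.swap_apply_self]
    rw [this, rename_id]
    rfl
  -- the swapped polynomial has the same data with `a ↔ c`
  have hcoeff : ∀ m : Fin 2 →₀ ℕ, coeff (Finsupp.mapDomain s m) (rename s G) = coeff m G := fun m =>
    coeff_rename_mapDomain s s.injective G m
  have m0 : Finsupp.mapDomain s (0 : Fin 2 →₀ ℕ) = 0 := Finsupp.mapDomain_zero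
  have m10 : Finsupp.mapDomain s (Finsupp.single 1 1 : Fin 2 →₀ ℕ) = Finsupp.single 0 1 := by rw [Finsupp.mapDomain_single, hs1]
  have m01 : Finsupp.mapDomain s (Finsupp.single 0 1 : Fin 2 →₀ ℕ) = Finsupp.single 1 1 := by rw [Finsupp.mapDomain_single, hs0]
  have m11 : Finsupp.mapDomain s (Finsupp.single 1 1 + Finsupp.single 0 1 : Fin 2 →₀ ℕ) = Finsupp.single 0 1 + Finsupp.single 1 1 := by
    rw [Finsupp.mapDomain_add, Finsupp.mapDomain_single, Finsupp.mapDomain_single, hs0, hs1]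
  have m20 : Finsupp.mapDomain s (Finsupp.single 1 2 : Fin 2 →₀ ℕ) = Finsupp.single 0 2 := by rw [Finsupp.mapDomain_single, hs1]
  have m02 : Finsupp.mapDomain s (Finsupp.single 0 2 : Fin 2 →₀ ℕ) = Finsupp.single 1 2 := by rw [Finsupp.mapDomain_single, hs0]
  have g00 : coeff 0 (rename s G) = 0 := by rw [← m0, hcoeff]; exact h00
  have g10 : coeff (Finsupp.single 0 1) (rename s G) = 0 := by rw [← m10, hcoeff]; exact h01
  have g01 : coeff (Finsupp.single 1 1) (rename s G) = 0 := by rw [← m01, hcoeff]; exact h10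
  have c11 : coeff (Finsupp.single 0 1 + Finsupp.single 1 1) (rename s G) = coeff (Finsupp.single 0 1 + Finsupp.single 1 1) G := by
    have h := hcoeff (Finsupp.single 1 1 + Finsupp.single 0 1)
    rw [m11, add_comm (Finsupp.single 1 1)] at h
    exact h
  have c20 : coeff (Finsupp.single 0 2) (rename s G) = coeff (Finsupp.single 1 2) G := by rw [← m20, hcoeff]
  have c02 : coeff (Finsupp.single 1 2) (rename s G) = coeff (Finsupp.single 0 2) G := by rw [← m02, hcoeff]
  have gdisc : IsUnit (coeff (Finsupp.single 0 1 + Finsupp.single 1 1) (rename s G) ^ 2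
      - 4 * coeff (Finsupp.single 0 2) (rename s G) * coeff (Finsupp.single 1 2) (rename s G)) := by
    rw [c11, c20, c02, mul_right_comm]
    exact hdisc
  obtain ⟨G₁, h1, ⟨A, B, C', hJ⟩, hndvd⟩ := node_strictTransform_chart O (rename s G) g00 g10 g01 gdisc
  refine ⟨rename s G₁, ?_, ⟨rename s A, rename s B, rename s C', ?_⟩, fun hdvd => hndvd ?_⟩
  · -- transport of the substitution identity along the swap
    have h := congrArg (rename s) h1
    rw [aeval_rename, ← AlgHom.comp_apply, comp_aeval, map_mul, map_pow, rename_X, hs1] at h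
    have hfun : (fun i : Fin 2 => if i = 1 then X 0 * X 1 else (X 0 : MvPolynomial (Fin 2) O)) =
        fun i => rename s (((fun i : Fin 2 => if i = 0 then X 0 * X 1 else (X 1 : MvPolynomial (Fin 2) O)) ∘ s) i) := by
      funext i
      fin_cases i <;> simp [hs0, hs1, mul_comm]
    rw [hfun]
    exact h
  · have h := congrArg (rename s) hJ
    rw [map_add, map_add, map_mul, map_mul, map_mul, map_one, rename_X, hs1, ← pderiv_rename s.injective, hs0] at h
    exact h
  · have h := map_dvd (rename s) hdvd
    rwa [rename_X, hs0, hss] at h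

end NodeChart

end Summit.ResolutionOfSingularities.ResolutionOfSingularities.Cruxes.EquisingularLiftNat.Sections

end
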